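import Mathlib
import Summits.Ventures.PercRepro2.RBDefs
import Summits.Ventures.PercRepro2.RBRoot

/-!
# Row 2′RB at a root or at a marker — the typed statement (mine-a g5)

`RBRoot.lean` proves the row with the Rao–Blackwell sum written out; this file identifies that
sum with `RB.rbSum` of RBDefs.lean (definitionally: `RB.Qst ends s t = (connEvent ends s t)ᶜ`)
and restates the result as the typed row: for every third vertex `w ∈ {s, t, b, o}`,
`RB.RBcross p ends o b s t w ∧ RB.RBsame p ends o b s t w` — the first kernel instances of the
row's typed statement (BHK 1.4 / 1.3 through the collapse, the B-frame same atom at `w = t`).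
-/

namespace Summit.Ventures.PercRepro2

namespace RB

open scoped Classical

variable {V : Type*} {E : Type*} [Fintype E] [DecidableEq E] [Fintype V] [DecidableEq V]
  {R : Type*} [Field R] [LinearOrder R] [IsStrictOrderedRing R]

omit [DecidableEq V] [LinearOrder R] [IsStrictOrderedRing R] in
/-- The written-out Rao–Blackwell sum of RBRoot.lean is `RB.rbSum`. -/
lemma rbSum_eq_rbRoot (p : E → R) (ends : E → Sym2 V) (s t w : V) (X Y : Set (Config E)) :
    rbSum p ends s t w X Y = RBRoot.rbSum p ends s t w X Y := rfl

omit [DecidableEq V] in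
/-- **Row 2′RB at every root and marker (typed)**: for `w ∈ {s, t, b, o}` both `RBcross` and
`RBsame` hold — the instances of the row in which one of the two events is measurable with
respect to `C(w)` (BHK 1.4 / 1.3), plus the B-frame same-type atom at `w = t`. -/
theorem RBcross_and_RBsame_of_mem {p : E → R} (hp : IsProbVec p) (ends : E → Sym2 V)
    (o b s t w : V) (hw : w = s ∨ w = t ∨ w = b ∨ w = o) :
    RBcross p ends o b s t w ∧ RBsame p ends o b s t w := by
  unfold RBcross RBsame
  rw [rbSum_eq_rbRoot, rbSum_eq_rbRoot]
  exact RBRoot.rb_of_mem ends hp o b s t w hw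

end RB

end Summit.Ventures.PercRepro2
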